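import Literature.AlgebraicGeometry.Motives.MixedHodgeStructureCatPureObjects
import Literature.AlgebraicGeometry.Motives.MixedHodgeStructureTateHomHodgeClasses
import Literature.AlgebraicGeometry.Motives.MixedHodgeStructureTransport
import Mathlib.CategoryTheory.Linear.Yoneda
import Mathlib.Algebra.Category.ModuleCat.Abelian
import HarnessLib

/-!
# Hodge classes as the corepresentable functor `Hom_MHS(ℚ(-p), −)` on `MixedHodgeStructureCat`

Layer `Literature/AlgebraicGeometry/Motives` (lane `lit-hodgefound`).  Arapura, §1: «Given a mixed Hodge structure `H`, set `Hodge(H) :=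
Hom_MHS(ℚ(0), H)»; with the Tate twist, the Hodge classes of type `(p,p)` of `H` — the rational vectors `v ∈ W_{2p}` with `v ∈ F^p` — are
the morphisms `ℚ(-p) → H` of mixed Hodge structures (the tree, UNBUNDLED: `MixedHodgeStructure.hodgeClasses H p`,
`MixedHodgeStructure.tateHomEquivHodgeClasses H p : Hom ℚ(-p) H ≃ Hdgᵖ(H)`, `f ↦ f(1)`; `Motives/MixedHodgeStructureTateHomHodgeClasses`),
and «`Hodge(−)`» is a left exact functor, exact on polarizable MHS of non-negative weight (Arapura, Lemma 1.1, second and third items; the tree's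
`Hom.map_hodgeClasses_eq_of_surjective`).  In the bundled `ℚ`-linear abelian category `MixedHodgeStructureCat` (g43-#3) this file provides:

* §1 the **Tate objects `tateObj j = ℚ(j)`** of `MixedHodgeStructureCat.{u}` (the tree's `HodgeStructure.tate j` on `ℚ`, transported to
  `ULift.{u} ℚ` by `MixedHodgeStructure.comapEquiv` so as to live in every universe), pure of weight `-2j`;
* §2 the `ℚ`-linear equivalence **`homTateLinearEquiv p X : (ℚ(-p) ⟶ X) ≃ₗ[ℚ] Hdgᵖ(X)`**, `f ↦ f(1)`;
* §3 the functor **`hodgeClassesFunctor p : MixedHodgeStructureCat ⥤ ModuleCat ℚ`** (`X ↦ Hdgᵖ(X)`, `f ↦ f|_{Hdg}`) and the natural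
  isomorphism **`tateCorepresentsIso p : Hom(ℚ(-p), −) ≅ hodgeClassesFunctor p`** with Mathlib's `linearCoyoneda` — **`Hdgᵖ` is
  corepresented by `ℚ(-p)`**; hence `Hdgᵖ` preserves all limits (`PreservesLimits`, in particular it is left exact);
* §4 vanishing and exactness: `Hom(ℚ(-p), X) = 0` when `W_{2p} X = 0` or `W_{2p-1} X = X` (`subsingleton_tateObj_hom_of_…`), and Arapura's
  Lemma 1.1 (2) in categorical dress: **`hodgeClassesFunctor_map_shortExact`** — `Hdgᵖ` of a short exact sequence `0 → X₁ → X₂ → X₃ → 0`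
  is short exact as soon as `X₂` is finite-dimensional with `W_{2p-1} X₂ = 0` and `Gr^W_{2p} X₂` polarizable.

Definitions with bodies (`tateObj`, `homTateLinearEquiv`, `hodgeClassesFunctor`, `tateCorepresentsIso`) and theorems; instances only of
Mathlib classes on this file's own functors (`PreservesLimits`); no notion, no named fact (0 new facts), no notation.

## Sources, verbatim

* D. Arapura, *Hodge cycles and the Leray filtration*, Pacific J. Math. 319 (2022), §1 (held text arXiv 2103.05038 p0003 L10–L35):
  «Given a mixed Hodge structure `H`, set `Hodge(H) := Hom_MHS(ℚ(0), H)`. The following facts will often be used without comment below.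
  Lemma 1.1. • There is an injection `Hodge(H) ↪ Hodge(Gr^W_0 H)`. It is an isomorphism if `H` has nonnegative weight, i.e. `W_{-1}H = 0`.
  • `Hodge(−)` is an exact functor on the category of polarizable mixed Hodge structures of nonnegative weight. • If `H₁ → H₂ → H₃` is an
  exact sequence of mixed Hodge structures, such that `H₁` is polarizable with nonnegative weight, then `Hodge(H₁) → Hodge(H₂) → Hodge(H₃)`
  is exact.»  (Here `Hdgᵖ(H) = Hodge(H(p)) = Hom_MHS(ℚ(-p), H)`.)
* P. Deligne, *Théorie de Hodge II*, Publ. Math. IHÉS 40 (1971), 2.1.13 (the Tate structure `ℤ(1)`, `ℚ(n)` of weight `-2n`), 2.3.1.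
* E. Cattani et al. (eds.), *Hodge Theory* (2014), Def. 3.2.16 (morphisms of MHS; transport of structure), Ex. 3.2.23 (4) (`ℚ(m)`).

## References

* [Arapura2022] D. Arapura, Hodge cycles and the Leray filtration, Pacific J. Math. 319 (2022) 233–258, §1, Lemma 1.1 (arXiv 2103.05038).
* [DeligneHodgeII1971] P. Deligne, Théorie de Hodge II, Publ. Math. IHÉS 40 (1971), 2.1.13, 2.3.1.
* [CattaniElZeinGriffithsLe2014] E. Cattani et al. (eds.), Hodge Theory (2014), Def. 3.2.16, Ex. 3.2.23.

## Provenance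

Lane `lit-hodgefound` (summit `HodgeConjecture`), seat `lit-hodgefound-p36` (literature-prover, generation 43, row g43-#11).
-/

noncomputable section

open CategoryTheory CategoryTheory.Limits Opposite

namespace Literature.AlgebraicGeometry.Motives

universe u

namespace MixedHodgeStructureCat

/-! ## §1 The Tate objects `ℚ(j)` -/

/-- The `ℚ`-linear identification `ULift ℚ ≃ ℚ` used to place the Tate structures in universe `u`. [cite: DeligneHodgeII1971, 2.1.13] -/
abbrev uliftRatEquiv : ULift.{u} ℚ ≃ₗ[ℚ] ℚ := ULift.moduleEquiv

/-- **The Tate object `ℚ(j)` of `MixedHodgeStructureCat.{u}`**: the one-dimensional pure Hodge structure of weight `-2j` and type `(-j,-j)`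
(the tree's `HodgeStructure.tate j`, regarded as an MHS and transported to `ULift.{u} ℚ`). [cite: DeligneHodgeII1971, 2.1.13 and 2.3.1]
[cite: CattaniElZeinGriffithsLe2014, Ex. 3.2.23 (4)] -/
def tateObj (j : ℤ) : MixedHodgeStructureCat.{u} :=
  of ((HodgeStructure.tate j).toMixedHodgeStructure.comapEquiv uliftRatEquiv.{u})

/-- `ℚ(j)` is pure of weight `-2j`. [cite: DeligneHodgeII1971, 2.1.13] -/
theorem isPure_tateObj (j : ℤ) : (tateObj.{u} j).str.IsPure (-2 * j) :=
  (HodgeStructure.isPure_toMixedHodgeStructure (HodgeStructure.tate j)).comapEquiv _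

/-- The morphism `ℚ(j) → ℚ(j)_{ULift}` identifying the tree's Tate MHS on `ℚ` with `tateObj j` (the transport morphism `e⁻¹`).
[cite: CattaniElZeinGriffithsLe2014, Def. 3.2.16] -/
abbrev toTateObj (j : ℤ) : MixedHodgeStructure.Hom (HodgeStructure.tate j).toMixedHodgeStructure (tateObj.{u} j).str :=
  MixedHodgeStructure.Hom.ofEquivSymm _ uliftRatEquiv.{u}

/-- The morphism `ℚ(j)_{ULift} → ℚ(j)` (the transport morphism `e`). [cite: CattaniElZeinGriffithsLe2014, Def. 3.2.16] -/
abbrev ofTateObj (j : ℤ) : MixedHodgeStructure.Hom (tateObj.{u} j).str (HodgeStructure.tate j).toMixedHodgeStructure :=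
  MixedHodgeStructure.Hom.ofEquiv _ uliftRatEquiv.{u}

/-! ## §2 `Hom(ℚ(-p), X) ≃ₗ Hdgᵖ(X)` -/

/-- The value at `1` of a morphism `ℚ(-p) → X` is a Hodge class of type `(p,p)`. [cite: Arapura2022, §1 (p. 3)] -/
theorem apply_one_mem_hodgeClasses (p : ℤ) {X : MixedHodgeStructureCat.{u}} (f : tateObj.{u} (-p) ⟶ X) :
    f.toLinearMap (ULift.up 1) ∈ X.str.hodgeClasses p :=
  MixedHodgeStructure.Hom.apply_one_mem_hodgeClasses p (MixedHodgeStructure.Hom.comp f (toTateObj (-p)))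

/-- **`Hom_MHS(ℚ(-p), X) ≃ₗ[ℚ] Hdgᵖ(X)`, `f ↦ f(1)`**, with inverse `v ↦ (q ↦ q • v)` (the tree's `tateHomEquivHodgeClasses`, made
`ℚ`-linear and universe polymorphic). [cite: Arapura2022, §1 (p. 3)] [cite: DeligneHodgeII1971, 2.3.1] -/
def homTateLinearEquiv (p : ℤ) (X : MixedHodgeStructureCat.{u}) : (tateObj.{u} (-p) ⟶ X) ≃ₗ[ℚ] X.str.hodgeClasses p where
  toFun f := ⟨f.toLinearMap (ULift.up 1), apply_one_mem_hodgeClasses p f⟩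
  map_add' _ _ := rfl
  map_smul' _ _ := rfl
  invFun v := MixedHodgeStructure.Hom.comp (MixedHodgeStructure.Hom.ofHodgeClass X.str p v) (ofTateObj (-p))
  left_inv f := MixedHodgeStructure.Hom.ext (LinearMap.ext fun q => by
    have hq : (q.down • ULift.up (1 : ℚ) : ULift.{u} ℚ) = q := ULift.ext _ _ (by simp)
    have key : f.toLinearMap q = q.down • f.toLinearMap (ULift.up 1) := by
      conv_lhs => rw [← hq]
      exact map_smul f.toLinearMap q.down (ULift.up 1)
    exact key.symm)
  right_inv v := Subtype.ext (by
    change (uliftRatEquiv.{u} (ULift.up 1)) • (v : X) = v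
    rw [ULift.moduleEquiv_apply, one_smul])

/-- `homTateLinearEquiv p X f = f(1)`. [cite: Arapura2022, §1 (p. 3)] -/
@[simp]
theorem coe_homTateLinearEquiv_apply (p : ℤ) {X : MixedHodgeStructureCat.{u}} (f : tateObj.{u} (-p) ⟶ X) :
    (homTateLinearEquiv p X f : X) = f.toLinearMap (ULift.up 1) := rfl

/-- The inverse: `(homTateLinearEquiv p X).symm v` is `q ↦ q • v`. [cite: Arapura2022, §1 (p. 3)] -/
@[simp]
theorem homTateLinearEquiv_symm_apply_toLinearMap_apply (p : ℤ) {X : MixedHodgeStructureCat.{u}} (v : X.str.hodgeClasses p)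
    (q : ULift.{u} ℚ) : MixedHodgeStructure.Hom.toLinearMap ((homTateLinearEquiv p X).symm v) q = q.down • (v : X) := rfl

/-- **A morphism `ℚ(-p) → X` vanishes iff its Hodge class `f(1)` does.** [cite: Arapura2022, §1 (p. 3)] -/
theorem tateObj_hom_eq_zero_iff (p : ℤ) {X : MixedHodgeStructureCat.{u}} (f : tateObj.{u} (-p) ⟶ X) :
    f = 0 ↔ f.toLinearMap (ULift.up 1) = 0 := by
  rw [← (homTateLinearEquiv p X).map_eq_zero_iff]
  exact ⟨fun h => congrArg Subtype.val h, fun h => Subtype.ext h⟩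

/-! ## §3 The functor `Hdgᵖ` and its corepresentability -/

/-- **The Hodge-classes functor `Hdgᵖ : MixedHodgeStructureCat ⥤ ModuleCat ℚ`** (`X ↦ Hdgᵖ(X)`, `f ↦ f|_{Hdgᵖ}` — morphisms of MHS
preserve Hodge classes, the tree's `Hom.apply_mem_hodgeClasses`). [cite: Arapura2022, §1 (p. 3), Lemma 1.1] -/
def hodgeClassesFunctor (p : ℤ) : MixedHodgeStructureCat.{u} ⥤ ModuleCat.{u} ℚ where
  obj X := ModuleCat.of ℚ (X.str.hodgeClasses p)
  map f := ModuleCat.ofHom (f.toLinearMap.restrict fun _ hv => f.apply_mem_hodgeClasses hv)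

/-- Values of `Hdgᵖ(f)` (by `rfl`). [cite: Arapura2022, §1 (p. 3), Lemma 1.1] -/
@[simp]
theorem coe_hodgeClassesFunctor_map_apply (p : ℤ) {X Y : MixedHodgeStructureCat.{u}} (f : X ⟶ Y) (v : X.str.hodgeClasses p) :
    Subtype.val (((hodgeClassesFunctor p).map f).hom v) = f.toLinearMap v := rfl

/-- `Hdgᵖ` is additive. [cite: Arapura2022, §1 (p. 3), Lemma 1.1] -/
instance (p : ℤ) : (hodgeClassesFunctor.{u} p).Additive where

/-- `Hdgᵖ` is `ℚ`-linear. [cite: Arapura2022, §1 (p. 3), Lemma 1.1] -/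
instance (p : ℤ) : (hodgeClassesFunctor.{u} p).Linear ℚ where

/-- **`Hdgᵖ ≅ Hom_MHS(ℚ(-p), −)`: the Hodge-classes functor is corepresented by the Tate object `ℚ(-p)`** (Mathlib's `ℚ`-linear
coYoneda functor of `ℚ(-p)`, naturally isomorphic to `hodgeClassesFunctor p` by `f ↦ f(1)`). [cite: Arapura2022, §1 (p. 3)]
[cite: DeligneHodgeII1971, 2.3.1] -/
def tateCorepresentsIso (p : ℤ) : (linearCoyoneda ℚ MixedHodgeStructureCat.{u}).obj (op (tateObj.{u} (-p))) ≅ hodgeClassesFunctor.{u} p :=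
  NatIso.ofComponents (fun X => (homTateLinearEquiv p X).toModuleIso) (fun _ => by ext; rfl)

/-- The components of `tateCorepresentsIso p` are the `homTateLinearEquiv p X`. [cite: Arapura2022, §1 (p. 3)] -/
theorem tateCorepresentsIso_hom_app_hom_apply (p : ℤ) (X : MixedHodgeStructureCat.{u}) (f : tateObj.{u} (-p) ⟶ X) :
    ((tateCorepresentsIso p).hom.app X).hom f = homTateLinearEquiv p X f := rfl

/-- `Hom_MHS(ℚ(j), −)` (with values in `ℚ`-vector spaces) preserves limits. [cite: Arapura2022, §1 (p. 3), Lemma 1.1] -/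
instance preservesLimits_linearCoyoneda_tateObj (j : ℤ) :
    PreservesLimits ((linearCoyoneda ℚ MixedHodgeStructureCat.{u}).obj (op (tateObj.{u} j))) :=
  have : PreservesLimits ((linearCoyoneda ℚ MixedHodgeStructureCat.{u}).obj (op (tateObj.{u} j)) ⋙ CategoryTheory.forget (ModuleCat.{u} ℚ)) :=
    (inferInstance : PreservesLimits (coyoneda.obj (op (tateObj.{u} j))))
  preservesLimits_of_reflects_of_preserves _ (CategoryTheory.forget (ModuleCat.{u} ℚ))

/-- **`Hdgᵖ` preserves limits** (it is corepresentable); in particular it is left exact. [cite: Arapura2022, §1 (p. 3) and Lemma 1.1 (2)] -/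
instance preservesLimits_hodgeClassesFunctor (p : ℤ) : PreservesLimits (hodgeClassesFunctor.{u} p) :=
  preservesLimits_of_natIso (tateCorepresentsIso p)

/-- `Hdgᵖ` is left exact. [cite: Arapura2022, §1 Lemma 1.1 (2)] -/
instance preservesFiniteLimits_hodgeClassesFunctor (p : ℤ) : PreservesFiniteLimits (hodgeClassesFunctor.{u} p) := inferInstance

/-- **Left exactness, concretely**: for a short exact `0 → X₁ → X₂ → X₃ → 0` in `MixedHodgeStructureCat`, `0 → Hdgᵖ X₁ → Hdgᵖ X₂ → Hdgᵖ X₃`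
is exact. [cite: Arapura2022, §1 Lemma 1.1 (2)] -/
theorem hodgeClassesFunctor_map_exact_mono (p : ℤ) {S : ShortComplex MixedHodgeStructureCat.{u}} (hS : S.ShortExact) :
    (S.map (hodgeClassesFunctor p)).Exact ∧ Mono (S.map (hodgeClassesFunctor p)).f :=
  (S.map (hodgeClassesFunctor p)).exact_and_mono_f_iff_f_is_kernel.2 ⟨KernelFork.mapIsLimit _ hS.fIsKernel (hodgeClassesFunctor p)⟩

/-! ## §4 Vanishing and Arapura's exactness -/

/-- **`Hdgᵖ(X) = 0` if `W_{2p} X = 0`** (all weights of `X` exceed `2p`). [cite: Arapura2022, §1 (p. 3)] -/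
theorem hodgeClasses_eq_bot_of_W_eq_bot {p : ℤ} {X : MixedHodgeStructureCat.{u}} (h : X.str.W (2 * p) = ⊥) : X.str.hodgeClasses p = ⊥ :=
  le_bot_iff.1 ((X.str.hodgeClasses_le_W p).trans h.le)

/-- **`Hdgᵖ(X) = 0` if `W_{2p-1} X = X`** (all weights of `X` are below `2p`): a Hodge class lying in `W_{2p-1}` vanishes.
[cite: Arapura2022, §1 (p. 3)] -/
theorem hodgeClasses_eq_bot_of_W_pred_eq_top {p : ℤ} {X : MixedHodgeStructureCat.{u}} (h : X.str.W (2 * p - 1) = ⊤) :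
    X.str.hodgeClasses p = ⊥ := by
  rw [Submodule.eq_bot_iff]
  intro v hv
  exact X.str.eq_zero_of_mem_hodgeClasses_of_mem_W hv (h ▸ Submodule.mem_top)

/-- **`Hom(ℚ(-p), X) = 0` when `Hdgᵖ(X) = 0`.** [cite: Arapura2022, §1 (p. 3)] -/
theorem subsingleton_tateObj_hom (p : ℤ) {X : MixedHodgeStructureCat.{u}} (h : X.str.hodgeClasses p = ⊥) :
    Subsingleton (tateObj.{u} (-p) ⟶ X) := by
  haveI : Subsingleton (X.str.hodgeClasses p) := by
    rw [h]
    infer_instance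
  exact (homTateLinearEquiv p X).toEquiv.subsingleton

/-- `Hom(ℚ(-p), X) = 0` if `W_{2p} X = 0`. [cite: Arapura2022, §1 (p. 3)] -/
theorem subsingleton_tateObj_hom_of_W_eq_bot {p : ℤ} {X : MixedHodgeStructureCat.{u}} (h : X.str.W (2 * p) = ⊥) :
    Subsingleton (tateObj.{u} (-p) ⟶ X) :=
  subsingleton_tateObj_hom p (hodgeClasses_eq_bot_of_W_eq_bot h)

/-- `Hom(ℚ(-p), X) = 0` if `W_{2p-1} X = X`. [cite: Arapura2022, §1 (p. 3)] -/
theorem subsingleton_tateObj_hom_of_W_pred_eq_top {p : ℤ} {X : MixedHodgeStructureCat.{u}} (h : X.str.W (2 * p - 1) = ⊤) :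
    Subsingleton (tateObj.{u} (-p) ⟶ X) :=
  subsingleton_tateObj_hom p (hodgeClasses_eq_bot_of_W_pred_eq_top h)

/-- **Arapura's Lemma 1.1 (2) in `MixedHodgeStructureCat`**: for a short exact sequence `0 → X₁ → X₂ → X₃ → 0` of MHS whose middle term is
finite-dimensional with `W_{2p-1} X₂ = 0` and `Gr^W_{2p} X₂` polarizable, the sequence `0 → Hdgᵖ X₁ → Hdgᵖ X₂ → Hdgᵖ X₃ → 0` is short exact
(left exactness is formal, §3; surjectivity on the right is the tree's `Hom.map_hodgeClasses_eq_of_surjective`).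
[cite: Arapura2022, §1 Lemma 1.1 (2)–(3)] -/
theorem hodgeClassesFunctor_map_shortExact (p : ℤ) {S : ShortComplex MixedHodgeStructureCat.{u}} (hS : S.ShortExact) [Module.Finite ℚ S.X₂]
    (hW : S.X₂.str.W (2 * p - 1) = ⊥) (hpol : (S.X₂.str.gr (2 * p)).IsPolarizable) : (S.map (hodgeClassesFunctor p)).ShortExact := by
  obtain ⟨hexact, hmono⟩ := hodgeClassesFunctor_map_exact_mono p hS
  haveI := hmono
  haveI : Epi (S.map (hodgeClassesFunctor p)).g := by
    rw [ModuleCat.epi_iff_surjective]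
    rintro ⟨v, hv⟩
    have hsurj : Function.Surjective S.g.toLinearMap := (epi_iff_surjective S.g).1 hS.epi_g
    have hv' : v ∈ (S.X₂.str.hodgeClasses p).map S.g.toLinearMap := by
      rw [S.g.map_hodgeClasses_eq_of_surjective hsurj hW hpol]
      exact hv
    obtain ⟨u, hu, rfl⟩ := hv'
    exact ⟨⟨u, hu⟩, rfl⟩
  exact { exact := hexact }

end MixedHodgeStructureCat

end Literature.AlgebraicGeometry.Motives

end
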